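import Summits.BirchSwinnertonDyer.BirchSwinnertonDyer.Theorems.KimAtThreeDeepUpperLedger
import Summits.BirchSwinnertonDyer.BirchSwinnertonDyer.Theorems.KimAtThreeDeepUpperSupplyLedger
import Summits.BirchSwinnertonDyer.Rank1Residual.GaloisImage.KatoKuriharaDictionaryThree
import Summits.BirchSwinnertonDyer.Rank1Residual.GaloisImage.KuriharaCertificateShallow
import Summits.BirchSwinnertonDyer.Rank1Residual.GaloisImage.KuriharaLowerBoundAssembly
import HarnessLib

/-!
# Route `KimAtThreeKolyvagin` (rung W2), crux `DeepUpperAtThree`: the END CORE at one deep level —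
# from cell n1011's DICT3 witness clauses, a generator of `KS₁`, the STUB at `∅` and ONE good core
# vertex to an explicit Kurihara-number certificate of the depth crux 19076 asks for

Cell `bsd-addord`, seat `bsd-addord-w2-c3` (D-0074 row B6), item `stmt-BirchSwinnertonDyer-19076`.
This file composes the seat's ledgers with cell n1011's ACTUAL dictionary currency
`KatoKuriharaWitnessAt W k t D v₃ P κ Λ κ′` (`GaloisImage/KatoKuriharaDictionaryThree.lean`: Kato's
derivative classes `κ_d ∈ H¹_{𝓕_can(d)}(ℚ, E[3^{k+1}])`, a genuine Kolyvagin system `κ′` with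
`κ′_d − κ_d ∈ ℤ⟨κ_c : c ⊊ d⟩`, the functional `Λ` on `𝓕_can(v₃)` onto `ℤ/3^{k+1}` with kernel the Kummer
part, and at every level `d` the value `Λ(loc κ_d) = u_d · 3^t · δ̃^{(k+1)}_{n(d)}(ψ_d)`), exactly as
n1011's `Assembly.pow_dvd_natCard_selmerGroup_of_certificate` does for the LOWER bound — but in the
UPPER direction, at ONE deep level `K = k + 1` (no second depth, no scalar transport, no certificate
INPUT: the certificate is the OUTPUT).

`EndCore.exists_certificate_of_witnessAt` — INPUTS at the level `K = k + 1`: the witness clauses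
`hW`; a generator `g` of `KS₁(E[3^K], 𝓕_can, 𝒫(D))` with every system a multiple (Sakamoto Thm.
4.4 (1), as n1011's binders `hg`/`hgen`); the Poitou–Tate count `#H¹_{𝓕_can} = 3^K · 3^{n₀}`; the STUB
decomposition of `g ∅` (Rubin 2011 Thm. 2.8.4 — a PORT at `p = 3`); the deep identification
`#Sel_{3^K}(E/ℚ) = #Ш(E/ℚ)[3^∞]` (`KimAtThreeDeepUpperSelmerSha`, rank `0`, `E[3]` irreducible,
`#Ш[3^∞] ∣ 3^K`); the `L`-value visibility `δ̃^{(K)}_1 = 3^a · unit` with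
`∂⁽⁰⁾(δ̃) = a` and `t + a < K` (n1011's `LValue.exists_lValue_witness` + kim3's
`kuriharaDivIndex_one_eq`); and ONE GOOD CORE VERTEX `d` of `D` — `Λ ∘ loc` injective on
`H¹_{𝓕_can(d)}` and `g d` of order `3^K` — whose number `n(d) = ∏_{𝔮 ∈ d} N𝔮` is a cyclic level of
`𝒩_{k₀}(E,3)` with `ν ≤ B`, all `N𝔮` prime. OUTPUT: a cyclic level `n ∈ 𝒩_{k₀}(E,3)` with `ν(n) ≤ B`
(namely `n(c)` for some `c ⊆ d`, possibly `c = ∅`) and an explicit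
`δ̃^{(K)}_n(ψ) = 3^γ · unit` with `γ ≤ a − ord₃ #Ш(E/ℚ)(3)`, `γ < K` — precisely the per-depth
witness of `KimAtThreeDeepUpperSupplyGlue.deepUpper_conclusion_of_supplyWitnesses_bounded`.
Mechanism: `κ′ = a′ • g`, `a′ = 3^α b`; at `∅` the upper ledger and `Sel = Ш` give
`ord₃ #Ш(3) ≤ t + a − α`; at `d`, `Λ(loc κ′_d) = 3^α · unit` (supply ledger); since
`κ′_d ≡ κ_d mod ℤ⟨κ_c : c ⊊ d⟩` (n1011 `Ledger.apply_mem_iff_of_sub_mem_closure`), SOME `c ⊆ d` has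
`Λ(loc κ_c) ∉ (3^{α+1})`, i.e. `3^t · δ̃_{n(c)} ∉ (3^{α+1})`, i.e. `ord₃ δ̃_{n(c)} ≤ α − t ≤ a − s`.
So on every tower row the conclusion of crux 19076 follows from such inputs AT EVERY DEPTH (glue).
TOOL theorem; every input a hypothesis in n1011's own currency; nothing asserted about any curve.
[cite: Kim2022StructureSelmer, Thm. 1.9 (6), Thm. 3.13, §3.4] [cite: MazurRubin2004, Thm. 4.3.4, App. A (33)]
[cite: Rubin2011, Thm. 2.8.4 (p. 25)] [cite: Sakamoto2024, Thm. 4.4 (1) (p. 926)] [cite: Kim2025RefinedTNC, §5 (5.2)–(5.3), Lemma 5.2]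
-/

set_option autoImplicit false
-- the Theorems namespace of a single-conjunct summit repeats the summit name by design (D-0017)
set_option linter.dupNamespace false

noncomputable section

open scoped Classical NumberField ContRepresentation
open Function NumberField IsDedekindDomain WeierstrassCurve CongruenceSubgroup
  Literature.NumberTheory.EllipticCurves Literature.NumberTheory.EllipticCurves.ModularForms
  Literature.NumberTheory.EllipticCurves.Rank1Residual
  Literature.NumberTheory.GaloisRepresentations
  Literature.NumberTheory.GaloisRepresentations.DiscreteGaloisModule Literature.NumberTheory.GaloisCohomology

namespace Summit.BirchSwinnertonDyer.BirchSwinnertonDyer.Theorems.KimAtThreeDeepUpperEndCore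

open Summit.BirchSwinnertonDyer.Rank1Residual.GaloisImage
open Summit.BirchSwinnertonDyer.BirchSwinnertonDyer.Theorems
open KimAtThreeDeepUpperLedger KimAtThreeDeepUpperSupplyLedger

namespace EndCore

/-! ## §1 Algebra in `ℤ/p^K` -/

section Algebra

variable {p : ℕ} [hp : Fact p.Prime]

/-- Every non-zero element of `ℤ/p^K` is `p^γ · (unit)` with `γ < K`. [folklore] -/
theorem exists_eq_pow_mul_unit_of_ne_zero {K : ℕ} (x : ZMod (p ^ K)) (hx : x ≠ 0) :
    ∃ γ : ℕ, γ < K ∧ ∃ w : (ZMod (p ^ K))ˣ, x = ((p ^ γ : ℕ) : ZMod (p ^ K)) * (w : ZMod (p ^ K)) := by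
  haveI : NeZero (p ^ K) := ⟨pow_ne_zero K hp.out.ne_zero⟩
  have hv0 : x.val ≠ 0 := fun h => hx ((ZMod.val_eq_zero x).1 h)
  obtain ⟨γ, m, hm, hval⟩ := Nat.exists_eq_pow_mul_and_not_dvd hv0 p hp.out.ne_one
  have hγK : γ < K := by
    by_contra hle
    rw [not_lt] at hle
    have h1 : p ^ K ∣ x.val := by
      rw [hval]; exact (Nat.pow_dvd_pow p hle).mul_right m
    have h2 : x.val < p ^ K := ZMod.val_lt x
    have h3 : 0 < x.val := Nat.pos_of_ne_zero hv0
    exact absurd (Nat.le_of_dvd h3 h1) (not_le.mpr h2)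
  have hmcop : Nat.Coprime m (p ^ K) :=
    Nat.Coprime.pow_right K ((Nat.Prime.coprime_iff_not_dvd hp.out).2 hm).symm
  refine ⟨γ, hγK, ZMod.unitOfCoprime m hmcop, ?_⟩
  rw [ZMod.coe_unitOfCoprime, ← Nat.cast_mul, ← hval, ZMod.natCast_zmod_val]

omit hp in
/-- If `x = p^γ · w` (`w` a unit) is not divisible by `p^{γ₀+1}` then `γ ≤ γ₀`. [folklore] -/
theorem le_of_not_pow_succ_dvd {K γ γ₀ : ℕ} {x : ZMod (p ^ K)} (w : (ZMod (p ^ K))ˣ)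
    (hx : x = ((p ^ γ : ℕ) : ZMod (p ^ K)) * (w : ZMod (p ^ K)))
    (h : ¬ ((p ^ (γ₀ + 1) : ℕ) : ZMod (p ^ K)) ∣ x) : γ ≤ γ₀ := by
  by_contra hlt
  rw [not_le] at hlt
  exact h (hx ▸ (Nat.cast_dvd_cast (Nat.pow_dvd_pow p hlt)).mul_right _)

end Algebra

/-! ## §2 Divisors of cyclic levels -/

/-- A divisor of a cyclic Kolyvagin level is a cyclic Kolyvagin level.
[cite: Kim2022StructureSelmer, §1.2.2 and §1.4.2 (PDF pp. 5, 7)] -/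
theorem isCyclicKolyvaginLevel_of_dvd (W : WeierstrassCurve ℚ) [W.IsGloballyMinimal] (p : ℕ)
    {m n : ℕ} (hn : IsCyclicKolyvaginLevel W p n) (hmn : m ∣ n) : IsCyclicKolyvaginLevel W p m :=
  ⟨hn.1.of_dvd hmn, fun ℓ _ hℓ => hn.2 ℓ (hℓ.trans hmn)⟩

/-! ## §3 The END core at one deep level -/

/-- **From n1011's DICT3 witness clauses + generator + STUB at `∅` + one good core vertex to the
certificate crux 19076 asks for** (see the module docstring; `K = k + 1`,
`s = ord₃ #Ш(E/ℚ)(3)`, `a = ∂⁽⁰⁾(δ̃)` for `f = P.f`). [cite: Kim2022StructureSelmer, Thm. 1.9 (6), Thm. 3.13]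
[cite: MazurRubin2004, Thm. 4.3.4, App. A (33)] [cite: Rubin2011, Thm. 2.8.4 (p. 25)] -/
theorem exists_certificate_of_witnessAt
    (W : WeierstrassCurve ℚ) [W.IsElliptic] [W.IsGloballyMinimal]
    (t k : ℕ) (D : KolyvaginDatum (W.torsionGaloisModule (((3 : ℕ) : ℤ) ^ k * ((3 : ℕ) : ℤ))))
    (v₃ : HeightOneSpectrum (𝓞 ℚ)) (hv₃ : ((3 : ℕ) : 𝓞 ℚ) ∈ v₃.asIdeal)
    {N : ℕ} [NeZero N] (P : ModularParametrizationData W N)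
    -- the DICT3 witness clauses at depth `k`
    {κ : Finset (HeightOneSpectrum (𝓞 ℚ)) →
      galoisCohomology (W.torsionGaloisModule (((3 : ℕ) : ℤ) ^ k * ((3 : ℕ) : ℤ))) 1}
    {Λ : galoisCohomology ((W.torsionGaloisModule (((3 : ℕ) : ℤ) ^ k * ((3 : ℕ) : ℤ))).toLocal
      (Sum.inr v₃)) 1 →+ ZMod (3 ^ (k + 1))}
    {κ' : Finset (HeightOneSpectrum (𝓞 ℚ)) →
      galoisCohomology (W.torsionGaloisModule (((3 : ℕ) : ℤ) ^ k * ((3 : ℕ) : ℤ))) 1}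
    (hW : KatoKuriharaWitnessAt W k t D v₃ P κ Λ κ')
    -- a generator of `KS₁` (Sakamoto Thm. 4.4 (1)) with every Kolyvagin system a multiple
    (g : Finset (HeightOneSpectrum (𝓞 ℚ)) →
      galoisCohomology (W.torsionGaloisModule (((3 : ℕ) : ℤ) ^ k * ((3 : ℕ) : ℤ))) 1)
    (hgen : ∀ κ'' ∈ D.kolyvaginSystems (propagatedSelmerStructure W 3 k), ∃ a' : ℕ, κ'' = a' • g)
    -- the empty level: count, STUB, `Sel = Ш` inputs, the `L`-value
    {n₀ : ℕ} (hcount : Nat.card (propagatedSelmerStructure W 3 k).selmerGroup = 3 ^ (k + 1) * 3 ^ n₀)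
    (hstub : ∃ e ∈ (propagatedSelmerStructure W 3 k).selmerGroup,
      ∃ m ∈ (W.kummerSelmerStructure (((3 : ℕ) : ℤ) ^ k * ((3 : ℕ) : ℤ))).selmerGroup,
        g ∅ = 3 ^ n₀ • e + m)
    (hSelSha : Nat.card (W.kummerSelmerStructure (((3 : ℕ) : ℤ) ^ k * ((3 : ℕ) : ℤ))).selmerGroup =
      Nat.card (AddCommGroup.primaryComponent W.sha 3))
    {a : ℕ} (hta : t + a < k + 1) (w₀ : (ZMod (3 ^ (k + 1)))ˣ)
    (hKur : ∀ ψ : (ℓ : ℕ) → (ZMod ℓ)ˣ →* Multiplicative (ZMod (3 ^ (k + 1))),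
      kuriharaNumber P.f (3 ^ (k + 1)) 1 ψ = ((3 ^ a : ℕ) : ZMod (3 ^ (k + 1))) * (w₀ : ZMod _))
    -- ONE good core vertex `d`
    (d : Finset (HeightOneSpectrum (𝓞 ℚ))) (hd : D.IsLevel d)
    (hprime : ∀ q ∈ d, (Ideal.absNorm q.asIdeal).Prime)
    {k₀ B : ℕ} (hcyc : IsCyclicKolyvaginLevel W 3 (∏ q ∈ d, Ideal.absNorm q.asIdeal))
    (hlev : Kato.IsKolyvaginProduct W 3 k₀ (∏ q ∈ d, Ideal.absNorm q.asIdeal))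
    (hν : (∏ q ∈ d, Ideal.absNorm q.asIdeal).primeFactors.card ≤ B)
    (hinj : ∀ x ∈ (D.atLevel (propagatedSelmerStructure W 3 k) d).selmerGroup,
      Λ (galoisCohomology.localization _ (Sum.inr v₃) 1 x) = 0 → x = 0)
    (hgd : g d ∈ (D.atLevel (propagatedSelmerStructure W 3 k) d).selmerGroup)
    (hord : addOrderOf (g d) = 3 ^ (k + 1)) :
    ∃ (n : ℕ) (_ : NeZero n), IsCyclicKolyvaginLevel W 3 n ∧ Kato.IsKolyvaginProduct W 3 k₀ n ∧
      n.primeFactors.card ≤ B ∧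
      ∃ (γ : ℕ) (ψ : (ℓ : ℕ) → (ZMod ℓ)ˣ →* Multiplicative (ZMod (3 ^ (k + 1))))
        (w : (ZMod (3 ^ (k + 1)))ˣ),
        γ ≤ a - padicValNat 3 (Nat.card (AddCommGroup.primaryComponent W.sha 3)) ∧ γ < k + 1 ∧
        (∀ ℓ ∈ n.primeFactors, Function.Surjective (ψ ℓ)) ∧
        kuriharaNumber P.f (3 ^ (k + 1)) n ψ = ((3 ^ γ : ℕ) : ZMod (3 ^ (k + 1))) * (w : ZMod _) := by
  haveI : Fact (Nat.Prime 3) := ⟨Nat.prime_three⟩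
  haveI : NeZero (3 ^ (k + 1)) := ⟨pow_ne_zero _ three_ne_zero⟩
  set s := padicValNat 3 (Nat.card (AddCommGroup.primaryComponent W.sha 3)) with hs_def
  obtain ⟨hκmem, ⟨hκ'KS, hbridge⟩, -, hker, hdict⟩ := hW
  -- Kato's Kolyvagin system on the generator: `κ′ = a′ • g`
  obtain ⟨a', ha'⟩ := hgen κ' hκ'KS
  -- the empty level: `κ′_∅ = κ_∅`, the dictionary value `Λ(loc κ_∅) = u · 3^t · 3^a · w₀`
  have hbr₀ : κ' ∅ = κ ∅ := by
    have h := hbridge ∅ D.isLevel_empty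
    have hcl : AddSubgroup.closure {x | ∃ c, c ⊂ (∅ : Finset (HeightOneSpectrum (𝓞 ℚ))) ∧ x = κ c}
        = ⊥ := by
      rw [AddSubgroup.closure_eq_bot_iff]
      rintro x ⟨c, hc, -⟩
      exact absurd hc (Finset.not_ssubset_empty c)
    rw [hcl, AddSubgroup.mem_bot, sub_eq_zero] at h
    exact h
  obtain ⟨u, ψ₀, -, hval₀⟩ := hdict ∅ D.isLevel_empty
  have hδ₁ : Λ (galoisCohomology.localization _ (Sum.inr v₃) 1 (κ ∅)) =
      (u : ZMod (3 ^ (k + 1))) * (3 : ZMod (3 ^ (k + 1))) ^ t *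
        (((3 ^ a : ℕ) : ZMod (3 ^ (k + 1))) * (w₀ : ZMod _)) := by
    rw [hval₀]
    congr 1
    have h1 := hKur ψ₀
    simpa using h1
  -- `a′ ≠ 0` (the empty-level value is non-zero at a deep level), `a′ = 3^α · b`
  have ha'0 : a' ≠ 0 := by
    intro h0
    have hz : κ' ∅ = 0 := by rw [ha', h0, zero_smul, Pi.zero_apply]
    have : Λ (galoisCohomology.localization _ (Sum.inr v₃) 1 (κ ∅)) = 0 := by
      rw [← hbr₀, hz, map_zero, map_zero]
    rw [hδ₁] at this
    have hne := DeepLedger.pow_mul_unit_ne_zero 3 hta (u * w₀)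
    apply hne
    rw [← this, Units.val_mul]
    push_cast
    ring
  obtain ⟨α, b, hb, hab⟩ := Nat.exists_eq_pow_mul_and_not_dvd ha'0 3 (by norm_num)
  have hκ'g : ∀ c, κ' c = (3 ^ α * b) • g c := fun c => by rw [ha', hab, Pi.smul_apply]
  -- the UPPER ledger at `∅` + `Sel = Ш`: `s ≤ t + a − α`
  obtain ⟨e, he, m, hm, hstub'⟩ := hstub
  obtain ⟨hαle, hup⟩ := DeepLedgerUpper.natCard_selmerGroup_kummer_dvd_pow_of_stub_of_kato W 3 k
    (by norm_num) hv₃ Λ hker (κ₀ := κ ∅) (κ₀' := κ' ∅) hbr₀ hta u w₀ rfl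
    (by rw [hδ₁]; push_cast; ring) hb (hκ'g ∅) hcount he hm hstub'
  have hsle : s ≤ t + a - α := by
    rw [hSelSha] at hup
    obtain ⟨i, hi, hcard⟩ := (Nat.dvd_prime_pow Nat.prime_three).1 hup
    rw [hs_def, hcard, padicValNat.prime_pow]
    exact hi
  -- at the vertex: `Λ(loc κ′_d) = 3^α · (unit)`, hence `∉ (3^{α+1})`
  let L : galoisCohomology (W.torsionGaloisModule (((3 : ℕ) : ℤ) ^ k * ((3 : ℕ) : ℤ))) 1 →+
      ZMod (3 ^ (k + 1)) :=
    Λ.comp (galoisCohomology.localization _ (Sum.inr v₃) 1)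
  have hL : ∀ x, L x = Λ (galoisCohomology.localization _ (Sum.inr v₃) 1 x) := fun _ => rfl
  obtain ⟨wg, hwg⟩ := SupplyLedger.isUnit_apply_of_injOn_of_addOrderOf_eq L
    (D.atLevel (propagatedSelmerStructure W 3 k) d).selmerGroup (fun x hx h0 => hinj x hx h0) hgd hord
  set J : Ideal (ZMod (3 ^ (k + 1))) := Ideal.span {((3 ^ (α + 1) : ℕ) : ZMod (3 ^ (k + 1)))} with hJ
  have hκ'd : L (κ' d) ∉ J := by
    rw [hκ'g d, map_nsmul, ← hwg, nsmul_eq_mul, hJ, Ideal.mem_span_singleton]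
    intro hdvd
    have hbcop : Nat.Coprime b (3 ^ (k + 1)) :=
      Nat.Coprime.pow_right _ ((Nat.Prime.coprime_iff_not_dvd Nat.prime_three).2 hb).symm
    have h' : ((3 ^ (α + 1) : ℕ) : ZMod (3 ^ (k + 1))) ∣ ((3 ^ α : ℕ) : ZMod (3 ^ (k + 1))) *
        ((ZMod.unitOfCoprime b hbcop * wg : (ZMod (3 ^ (k + 1)))ˣ) : ZMod _) := by
      rw [Units.val_mul, ZMod.coe_unitOfCoprime]
      push_cast at hdvd ⊢
      simpa [mul_assoc] using hdvd
    have := DeepLedgerUpper.le_of_pow_dvd_pow_mul_unit (p := 3) (by omega) _ h'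
    omega
  -- SOME sub-level `c ⊆ d` has `Λ(loc κ_c) ∉ (3^{α+1})`
  have hexists : ∃ c, c ⊆ d ∧ L (κ c) ∉ J := by
    by_contra hall
    push Not at hall
    have hJ' : ∀ c, c ⊂ d → L (κ c) ∈ J := fun c hc => hall c hc.subset
    have hiff := Ledger.apply_mem_iff_of_sub_mem_closure L J κ κ' d (hbridge d hd) hJ'
    exact hκ'd (hiff.2 (hall d subset_rfl))
  obtain ⟨c, hcd, hc⟩ := hexists
  have hlc : D.IsLevel c := fun q hq => hd (hcd hq)
  -- the dictionary at `c`: `u_c · 3^t · δ̃_{n(c)} ∉ (3^{α+1})`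
  obtain ⟨uc, ψ, hψ, hvalc⟩ := hdict c hlc
  set nc : ℕ := ∏ q ∈ c, Ideal.absNorm q.asIdeal with hnc
  have hnc0 : nc ≠ 0 := Finset.prod_ne_zero_iff.2 fun q _ => Assembly.absNorm_ne_zero q
  haveI : NeZero nc := ⟨hnc0⟩
  set δ := kuriharaNumber P.f (3 ^ (k + 1)) nc ψ with hδ
  have hδne : ¬ ((3 ^ (α + 1) : ℕ) : ZMod (3 ^ (k + 1))) ∣ (3 : ZMod (3 ^ (k + 1))) ^ t * δ := by
    intro hdvd
    apply hc
    rw [hL, hvalc, hJ, Ideal.mem_span_singleton, mul_assoc]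
    exact hdvd.mul_left _
  -- hence `t ≤ α` and `δ ∉ (3^{α−t+1})`, and `δ = 3^γ · unit` with `γ ≤ α − t ≤ a − s`
  have htα : t ≤ α := by
    by_contra hlt
    rw [not_le] at hlt
    apply hδne
    have : ((3 ^ (α + 1) : ℕ) : ZMod (3 ^ (k + 1))) ∣ (3 : ZMod (3 ^ (k + 1))) ^ t := by
      rw [show ((3 ^ (α + 1) : ℕ) : ZMod (3 ^ (k + 1))) = (3 : ZMod _) ^ (α + 1) by push_cast; rfl]
      exact pow_dvd_pow _ hlt
    exact this.mul_right δ
  have hδne' : ¬ ((3 ^ (α - t + 1) : ℕ) : ZMod (3 ^ (k + 1))) ∣ δ := by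
    intro hdvd
    apply hδne
    have h1 : ((3 ^ (t + (α - t + 1)) : ℕ) : ZMod (3 ^ (k + 1))) ∣
        ((3 ^ t : ℕ) : ZMod (3 ^ (k + 1))) * δ :=
      (Ledger.pow_mul_dvd_pow_add_mul_iff (p := 3) (by omega) δ).2 hdvd
    rw [show t + (α - t + 1) = α + 1 by omega] at h1
    push_cast at h1 ⊢
    exact h1
  have hδ0 : δ ≠ 0 := fun h0 => hδne' (h0 ▸ dvd_zero _)
  obtain ⟨γ, hγK, w, hw⟩ := exists_eq_pow_mul_unit_of_ne_zero (p := 3) δ hδ0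
  have hγ : γ ≤ α - t := le_of_not_pow_succ_dvd (p := 3) w hw hδne'
  -- the package at the level `n(c)`
  have hdvdn : nc ∣ ∏ q ∈ d, Ideal.absNorm q.asIdeal := Finset.prod_dvd_prod_of_subset _ _ _ hcd
  refine ⟨nc, ⟨hnc0⟩, isCyclicKolyvaginLevel_of_dvd W 3 hcyc hdvdn, hlev.of_dvd hdvdn, ?_, γ, ψ, w,
    by omega, hγK, ?_, hw⟩
  · exact (Finset.card_le_card (Nat.primeFactors_mono hdvdn
      (Finset.prod_ne_zero_iff.2 fun q _ => Assembly.absNorm_ne_zero q))).trans hν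
  · exact Shallow.forall_primeFactors_of_forall_mem (fun q : HeightOneSpectrum (𝓞 ℚ) =>
      Ideal.absNorm q.asIdeal) c (fun q hq => hprime q (hcd hq))
      ((Assembly.absNorm_injOn _).mono (by intro q hq; exact hq)) hψ

end EndCore

end Summit.BirchSwinnertonDyer.BirchSwinnertonDyer.Theorems.KimAtThreeDeepUpperEndCore

end
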